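import Mathlib
import HarnessLib
import Literature.NumberTheory.Transcendental.KZCalculus
import Summits.KontsevichZagierPeriods.KontsevichZagierPeriods.Theorems.MzvKernelInKZTwoPosetsCubicalChart
import Summits.KontsevichZagierPeriods.KontsevichZagierPeriods.Theorems.FurushoPentagonHoffmanRelationInKZCubicalTransportAux
import Summits.KontsevichZagierPeriods.KontsevichZagierPeriods.Theorems.LinRedNormalFormDihedralNormalFormStubAtomReductionAux1
import Summits.KontsevichZagierPeriods.KontsevichZagierPeriods.Theorems.LinRedNormalFormDihedralNormalFormStubAtomReductionAux3

/-!
# Stub `stub_atomReduction`, tools V: the cubical chart of a genus-zero integrand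

Registered sub-goal of this file: `stub_atomReduction_faces`.

* `exists_cube_rep_of_simplex_rep` — the chart step (rule 2): a representation on the open ordered
  simplex is KZ-equivalent to its pull-back to the open cube along `tᵢ = x₀ ⋯ xᵢ`
  (`FurushoPentagon.HoffmanRelationInKZ.monomialChart_transport`);
* `pullback_shape` — in the chart, `genus-zero integrand × Jacobian = N(x) · M(x) · K(x)` with `N`
  the polynomial `p(x₀, x₀x₁, …)`, `M` a Laurent monomial and `K` a product of integer powers of
  chords (`tᵢ - tⱼ = tᵢ (1 - x_{i+1} ⋯ xⱼ)`, `1 - tᵢ = 1 - x₀ ⋯ xᵢ`);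
* `exists_content` — monomial content: `N = x^m · Ñ` with `Ñ` of zero content;
* `exponent_nonneg` — FACES: if `Ñ · x^d · K` is absolutely integrable on the cube then `d ≥ 0`
  (lowest-power lemma on the half cube `(0, ½)ᵏ`, where the chords are units);
* `aeval_taylor` — CORNERS: the Taylor expansion `Ñ(x) = ∑_ν c_ν (1 - x)^ν` at `x = 1`.

Recurring terms are written through parse-time notations (`CP⟪⟫`, `ATOM⟪⟫`, `SEC⟪⟫`, `NC⟪⟫`,
`CHORD⟪⟫`, `WEIGHT⟪⟫`, `EXPL⟪⟫`, `CPOLY⟪⟫`, `DIAG⟪⟫`, …); the files introduce no definitions.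
-/

noncomputable section

open MeasureTheory Set MvPolynomial Filter Topology

namespace Summit.KontsevichZagierPeriods.DihedralNormalForm.TorusDescent.AtomReduction

open Summit.KontsevichZagierPeriods.MzvKernelInKZ
open Summit.KontsevichZagierPeriods.FurushoPentagon.HoffmanRelationInKZ
  (hasFDerivAt_monomialChart det_monomialChart)
open Literature.NumberTheory.Transcendental
open Literature.ModelTheory.ExponentialFields (IsSemialgebraic)

/-! ### Notation (parse-time abbreviations; no definitions are introduced) -/

set_option quotPrecheck false

local notation "CP⟪" k ", " i ", " j ", " x "⟫" =>
  (∏ l : Fin k, if i ≤ l ∧ l ≤ j then x l else (1:ℝ))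
local notation "ATOM⟪" k ", " a ", " e ", " x "⟫" =>
  ((∏ i : Fin k, x i ^ (a i : ℕ)) *
    ∏ i : Fin k, ∏ j : Fin k, if i ≤ j then (1 - CP⟪k, i, j, x⟫) ^ (e i j : ℤ) else (1:ℝ))

set_option quotPrecheck true

/-! ### The cubical chart of the simplex (rule 2) -/

section Chart

open Summit.KontsevichZagierPeriods.FurushoPentagon.HoffmanRelationInKZ (monomialChart_transport)

variable {k : ℕ}

/-- **Chart step.** A representation on the open ordered simplex with integrand `≡ h` is
KZ-equivalent (one change of variables along the cubical chart `tᵢ = x₀⋯xᵢ`) to a representation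
on the open cube with integrand `(h ∘ cubicalMap) · |Jacobian|`. -/
theorem exists_cube_rep_of_simplex_rep (r : KZ.IntegralRep k) (h : (Fin k → ℝ) → ℝ)
    (hdom : r.domain = {t | (∀ i, 0 < t i) ∧ (∀ i, t i < 1) ∧ StrictAnti t})
    (hint : EqOn r.integrand h r.domain) :
    ∃ r₁ : KZ.IntegralRep k, r₁.domain = {x : Fin k → ℝ | ∀ i, x i ∈ Ioo (0:ℝ) 1} ∧
      r₁.integrand = (fun y => h (TwoPosets.cubicalMap k y) *
        |∏ i, ∏ l ∈ (Finset.univ.filter (fun j => j ≤ i)).erase i, y l|) ∧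
      KZ.of r - KZ.of r₁ ∈ KZ.relations := by
  have hS : ∀ i : Fin k, ∀ j ∈ Finset.univ.filter (fun j => j ≤ i), j ≤ i := fun i j hj =>
    (Finset.mem_filter.mp hj).2
  have hS' : ∀ i : Fin k, i ∈ Finset.univ.filter (fun j => j ≤ i) := fun i =>
    Finset.mem_filter.mpr ⟨Finset.mem_univ _, le_rfl⟩
  have hT := monomialChart_transport (fun i : Fin k => Finset.univ.filter (fun j => j ≤ i))
    hS hS' (TwoPosets.isSemialgebraic_cube k) (TwoPosets.cubicalMap k) (fun _ _ => rfl)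
    (TwoPosets.injOn_cubicalMap k)
    (fun y => h (TwoPosets.cubicalMap k y) *
      |∏ i, ∏ l ∈ (Finset.univ.filter (fun j => j ≤ i)).erase i, y l|) h (fun _ _ => rfl)
  have hdom' : r.domain = TwoPosets.cubicalMap k '' TwoPosets.cube k := by
    rw [TwoPosets.image_cubicalMap, hdom]; rfl
  obtain ⟨r₁, hr₁d, hr₁i⟩ := hT.1 r hdom' hint
  refine ⟨r₁, hr₁d, hr₁i, ?_⟩
  have := hT.2 r₁ r hr₁d (fun y _ => by rw [hr₁i]) hdom' hint
  simpa [KZ.Equivalent] using KZ.relations.neg_mem this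

/-- On the open cube the Jacobian factor of the cubical chart is `∏ⱼ xⱼ^{k-1-j}`. -/
theorem abs_jacobian_eq {y : Fin k → ℝ} (hy : ∀ i, y i ∈ Ioo (0:ℝ) 1) :
    |∏ i, ∏ l ∈ (Finset.univ.filter (fun j => j ≤ i)).erase i, y l| =
      ∏ j, y j ^ (k - 1 - (j : ℕ)) := by
  rw [TwoPosets.prod_prod_erase_filter_le, abs_of_pos (TwoPosets.jacobian_pos hy)]

end Chart

/-! ### The pulled-back genus-zero integrand in atom shape -/

section Pullback

variable {n : ℕ}

/-- The first chord products are the partial products of the chart: `cp 0 i x = x₀ ⋯ xᵢ`. -/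
theorem cp_zero_eq (i : Fin (n + 1)) (x : Fin (n + 1) → ℝ) :
    CP⟪(n + 1), 0, i, x⟫ = ∏ j ∈ Finset.univ.filter (fun j => j ≤ i), x j := by
  rw [Finset.prod_filter]
  refine Finset.prod_congr rfl fun l _ => ?_
  simp

/-- Differences of partial products factor through a chord:
`x₀⋯xᵢ - x₀⋯xⱼ = x₀⋯xᵢ · (1 - x_{i+1}⋯xⱼ)` for `i < j`. -/
theorem pprod_sub_pprod (i : Fin n) (j : Fin (n + 1)) (hij : i.castSucc < j)
    (x : Fin (n + 1) → ℝ) :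
    (∏ l ∈ Finset.univ.filter (fun l => l ≤ i.castSucc), x l) -
        ∏ l ∈ Finset.univ.filter (fun l => l ≤ j), x l =
      (∏ l ∈ Finset.univ.filter (fun l => l ≤ i.castSucc), x l) * (1 - CP⟪(n + 1), i.succ, j, x⟫) := by
  have key : (∏ l ∈ Finset.univ.filter (fun l => l ≤ j), x l) =
      (∏ l ∈ Finset.univ.filter (fun l => l ≤ i.castSucc), x l) * CP⟪(n + 1), i.succ, j, x⟫ := by
    rw [Finset.prod_filter, Finset.prod_filter, ← Finset.prod_mul_distrib]
    refine Finset.prod_congr rfl fun l _ => ?_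
    by_cases hl : l ≤ i.castSucc
    · have h1 : l ≤ j := hl.trans hij.le
      have h2 : ¬ (i.succ ≤ l ∧ l ≤ j) := fun h =>
        absurd (Fin.castSucc_lt_iff_succ_le.2 h.1) (not_lt.2 hl)
      rw [if_pos h1, if_pos hl, if_neg h2, mul_one]
    · have h3 : i.succ ≤ l := Fin.castSucc_lt_iff_succ_le.1 (not_le.1 hl)
      rw [if_neg hl, one_mul]
      by_cases h4 : l ≤ j
      · rw [if_pos h4, if_pos ⟨h3, h4⟩]
      · rw [if_neg h4, if_neg (fun h => h4 h.2)]
  rw [key]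
  ring

/-- **Pull-back shape.** In the cubical chart `t = cubicalMap x` of the simplex, the genus-zero
integrand times the Jacobian is `N(x) · M(x) · K(x)` on the open cube, with
`N = p(x₀, x₀x₁, …)` a polynomial, `M` a Laurent monomial and `K` a product of integer powers of
chords. -/
theorem pullback_shape (p : MvPolynomial (Fin (n + 1)) ℚ) (a : Fin (n + 1) → Fin (n + 1) → ℕ)
    (b c : Fin (n + 1) → ℕ) :
    ∃ (M K : (Fin (n + 1) → ℝ) → ℝ),
      (∃ d : Fin (n + 1) → ℤ, ∀ x : Fin (n + 1) → ℝ, (∀ i, x i ∈ Ioo (0:ℝ) 1) →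
        M x = ∏ l, x l ^ d l) ∧
      (∃ e : Fin (n + 1) → Fin (n + 1) → ℤ, ∀ x : Fin (n + 1) → ℝ, (∀ i, x i ∈ Ioo (0:ℝ) 1) →
        K x = ∏ i, ∏ j, if i ≤ j then (1 - CP⟪(n + 1), i, j, x⟫) ^ e i j else 1) ∧
      ∀ x : Fin (n + 1) → ℝ, (∀ i, x i ∈ Ioo (0:ℝ) 1) →
        MvPolynomial.aeval (TwoPosets.cubicalMap (n + 1) x) p /
            ((∏ i, TwoPosets.cubicalMap (n + 1) x i ^ b i) *
              (∏ i, (1 - TwoPosets.cubicalMap (n + 1) x i) ^ c i) *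
              ∏ i, ∏ j, if i < j then
                (TwoPosets.cubicalMap (n + 1) x i - TwoPosets.cubicalMap (n + 1) x j) ^ a i j
                else 1) *
          (∏ j, x j ^ (n + 1 - 1 - (j : ℕ))) =
        MvPolynomial.aeval x (bind₁ (fun i => ∏ l ∈ Finset.univ.filter (fun l => l ≤ i), X l) p) *
          M x * K x := by
  -- the four factors of the denominator
  set T : (Fin (n + 1) → ℝ) → Fin (n + 1) → ℝ := fun x i =>
    ∏ l ∈ Finset.univ.filter (fun l => l ≤ i), x l with hT
  have hTc : ∀ x i, TwoPosets.cubicalMap (n + 1) x i = T x i := fun _ _ => rfl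
  set Tb : (Fin (n + 1) → ℝ) → ℝ := fun x => ∏ i, T x i ^ b i with hTb
  set Cc : (Fin (n + 1) → ℝ) → ℝ := fun x => ∏ i, (1 - CP⟪(n + 1), 0, i, x⟫) ^ c i with hCc
  set Ta : (Fin (n + 1) → ℝ) → ℝ := fun x => ∏ i : Fin n, ∏ j : Fin (n + 1),
    if i.castSucc < j then T x i.castSucc ^ a i.castSucc j else 1 with hTa
  set Ca : (Fin (n + 1) → ℝ) → ℝ := fun x => ∏ i : Fin n, ∏ j : Fin (n + 1),
    if i.castSucc < j then (1 - CP⟪(n + 1), i.succ, j, x⟫) ^ a i.castSucc j else 1 with hCa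
  refine ⟨fun x => (∏ j, x j ^ (n + 1 - 1 - (j : ℕ))) / (Tb x * Ta x), fun x => (Cc x * Ca x)⁻¹,
    ?_, ?_, fun x hx => ?_⟩
  · -- `M` is a Laurent monomial
    refine isMono_mul (isMono_prod_pow _) (isMono_inv (isMono_mul ?_ ?_))
    · exact isMono_finset_prod _ fun i _ => isMono_pow (isMono_pprod i) _
    · refine isMono_finset_prod _ fun i _ => isMono_finset_prod _ fun j _ => ?_
      exact isMono_ite _ (isMono_pow (isMono_pprod _) _) isMono_one
  · -- `K` is chordal
    refine isChordal_inv (isChordal_mul ?_ ?_)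
    · exact isChordal_finset_prod _ fun i _ => isChordal_pow (isChordal_chord (Fin.zero_le _)) _
    · refine isChordal_finset_prod _ fun i _ => isChordal_finset_prod _ fun j _ => ?_
      by_cases hij : i.castSucc < j
      · simp only [hij, if_true]
        exact isChordal_pow (isChordal_chord (Fin.castSucc_lt_iff_succ_le.1 hij)) _
      · simp only [hij, if_false]
        exact isChordal_one
  · -- the identity on the open cube
    have hT0 : ∀ i, 0 < T x i := fun i => Finset.prod_pos fun l _ => (hx l).1
    have hTb0 : 0 < Tb x := Finset.prod_pos fun i _ => pow_pos (hT0 i) _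
    have hTa0 : 0 < Ta x := Finset.prod_pos fun i _ => Finset.prod_pos fun j _ => by
      split_ifs
      · exact pow_pos (hT0 _) _
      · exact one_pos
    have hCc0 : 0 < Cc x := Finset.prod_pos fun i _ =>
      pow_pos (one_sub_cp_pos (Fin.zero_le _) hx) _
    have hCa0 : 0 < Ca x := Finset.prod_pos fun i _ => Finset.prod_pos fun j _ => by
      split_ifs with h
      · exact pow_pos (one_sub_cp_pos (Fin.castSucc_lt_iff_succ_le.1 h) hx) _
      · exact one_pos
    -- numerator
    have hN : MvPolynomial.aeval (TwoPosets.cubicalMap (n + 1) x) p = MvPolynomial.aeval x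
        (bind₁ (fun i => ∏ l ∈ Finset.univ.filter (fun l => l ≤ i), X l) p) := by
      have hfun : (fun i => MvPolynomial.aeval x
          (∏ l ∈ Finset.univ.filter (fun l => l ≤ i), (X l : MvPolynomial (Fin (n + 1)) ℚ))) =
          TwoPosets.cubicalMap (n + 1) x := by
        funext i
        rw [map_prod]
        simp only [aeval_X]
        rfl
      rw [aeval_bind₁, hfun]
    -- the `b`-factor and the `c`-factor
    have hB : (∏ i, TwoPosets.cubicalMap (n + 1) x i ^ b i) = Tb x := rfl
    have hC : (∏ i, (1 - TwoPosets.cubicalMap (n + 1) x i) ^ c i) = Cc x := by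
      simp only [hCc, cp_zero_eq]
      rfl
    -- the `a`-factor
    have hA : (∏ i, ∏ j, if i < j then
        (TwoPosets.cubicalMap (n + 1) x i - TwoPosets.cubicalMap (n + 1) x j) ^ a i j else 1) =
        Ta x * Cc x / Cc x * Ca x := by
      rw [mul_div_cancel_right₀ _ hCc0.ne', hTa, hCa]
      simp only [hTc]
      rw [Fin.prod_univ_castSucc]
      have hlast : (∏ j : Fin (n + 1), if Fin.last n < j then
          (T x (Fin.last n) - T x j) ^ a (Fin.last n) j else (1:ℝ)) = 1 :=
        Finset.prod_eq_one fun j _ => if_neg (not_lt.2 (Fin.le_last j))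
      rw [hlast, mul_one, ← Finset.prod_mul_distrib]
      refine Finset.prod_congr rfl fun i _ => ?_
      rw [← Finset.prod_mul_distrib]
      refine Finset.prod_congr rfl fun j _ => ?_
      split_ifs with hij
      · rw [hT]
        simp only
        rw [pprod_sub_pprod i j hij x, mul_pow]
      · rw [mul_one]
    rw [hN, hB, hC, hA]
    field_simp

end Pullback

/-! ### Monomial content and the Taylor expansion at `x = 1` -/

section Content

variable {k : ℕ}

/-- **Content extraction.** A non-zero polynomial is `x^m · Ñ` with `Ñ` of zero monomial content:
for every variable some monomial of `Ñ` does not involve it. -/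
theorem exists_content (N : MvPolynomial (Fin k) ℚ) (hN : N ≠ 0) :
    ∃ (m : Fin k →₀ ℕ) (Nt : MvPolynomial (Fin k) ℚ), N = monomial m 1 * Nt ∧
      ∀ l, ∃ μ ∈ Nt.support, μ l = 0 := by
  classical
  have hne : N.support.Nonempty := support_nonempty.2 hN
  set m : Fin k →₀ ℕ := Finsupp.equivFunOnFinite.symm
    fun l => (N.support.image fun μ => μ l).min' (hne.image _) with hm
  have hml : ∀ l, m l = (N.support.image fun μ => μ l).min' (hne.image _) := fun l => by
    simp [hm]
  have hmle : ∀ ν ∈ N.support, m ≤ ν := fun ν hν l => by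
    rw [hml]
    exact Finset.min'_le _ _ (Finset.mem_image_of_mem (fun μ => μ l) hν)
  refine ⟨m, N.divMonomial m, eq_monomial_mul_divMonomial N m hmle, fun l => ?_⟩
  have := Finset.min'_mem (N.support.image fun μ => μ l) (hne.image _)
  rw [Finset.mem_image] at this
  obtain ⟨μ₀, hμ₀, hμ₀l⟩ := this
  refine ⟨μ₀ - m, ?_, ?_⟩
  · rw [mem_support_iff, coeff_divMonomial, add_tsub_cancel_of_le (hmle μ₀ hμ₀)]
    exact mem_support_iff.1 hμ₀
  · rw [Finsupp.tsub_apply, hml, ← hμ₀l, Nat.sub_self]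

/-- Evaluating `x^m · Ñ`. -/
theorem aeval_monomial_mul (m : Fin k →₀ ℕ) (Nt : MvPolynomial (Fin k) ℚ) (x : Fin k → ℝ) :
    MvPolynomial.aeval x (monomial m 1 * Nt) = (∏ l, x l ^ m l) * MvPolynomial.aeval x Nt := by
  rw [map_mul, aeval_monomial, map_one, one_mul, Finsupp.prod_fintype _ _ fun i => pow_zero _]

/-- The substitution `X ↦ 1 - X` evaluated at `1 - x` returns the value at `x`. -/
theorem aeval_one_sub_bind₁ (Nt : MvPolynomial (Fin k) ℚ) (x : Fin k → ℝ) :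
    MvPolynomial.aeval (fun i => 1 - x i) (bind₁ (fun i => (1 : MvPolynomial (Fin k) ℚ) - X i) Nt) =
      MvPolynomial.aeval x Nt := by
  have hfun : (fun i => MvPolynomial.aeval (fun i => 1 - x i)
      ((1 : MvPolynomial (Fin k) ℚ) - X i)) = x := by
    funext i
    simp
  rw [aeval_bind₁, hfun]

/-- **Taylor expansion at `x = 1`**: `Ñ(x) = Ñ'(1 - x)` with `Ñ' = Ñ(1 - X)`, and `Ñ'(v)` is the
finite sum of its monomials. -/
theorem aeval_taylor (Nt : MvPolynomial (Fin k) ℚ) (x : Fin k → ℝ) :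
    MvPolynomial.aeval x Nt =
      ∑ ν ∈ (bind₁ (fun i => (1 : MvPolynomial (Fin k) ℚ) - X i) Nt).support,
        (((bind₁ (fun i => (1 : MvPolynomial (Fin k) ℚ) - X i) Nt).coeff ν : ℚ) : ℝ) *
          ∏ i, (1 - x i) ^ ν i := by
  rw [← aeval_one_sub_bind₁ Nt x, MvPolynomial.aeval_def, MvPolynomial.eval₂_eq']
  rfl

end Content

/-! ### Faces: non-negativity of the monomial exponents -/

section Faces

variable {n : ℕ}

/-- A lower bound for integer powers of a chord on the half cube `(0, ½)ⁿ⁺¹`. -/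
theorem chord_zpow_lower {i j : Fin (n + 1)} (hij : i ≤ j) (γ : ℤ) {x : Fin (n + 1) → ℝ}
    (hx : ∀ i, x i ∈ Ioo (0:ℝ) (1 / 2)) :
    ((2:ℝ) ^ γ.natAbs)⁻¹ * (1 / 2 : ℝ) ^ γ ≤ (1 - CP⟪(n + 1), i, j, x⟫) ^ γ := by
  have hx' : ∀ i, x i ∈ Ioo (0:ℝ) 1 := fun i => ⟨(hx i).1, (hx i).2.trans (by norm_num)⟩
  have h1 : 1 / 2 ≤ 1 - CP⟪(n + 1), i, j, x⟫ := by
    have := cp_le_apply hij hx'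
    linarith [(hx i).2]
  have h2 : 1 - CP⟪(n + 1), i, j, x⟫ ≤ 2 * (1 / 2) := by
    have := cp_pos i j hx'
    linarith
  exact (zpow_two_sided (by norm_num) h1 h2 (by norm_num) γ).1

/-- **Faces.** If `Ñ(x) · x^d · K(x)` (`K` chordal, `Ñ` of zero monomial content) is absolutely
integrable on the open cube, then `d ≥ 0`. -/
theorem exponent_nonneg (Nt : MvPolynomial (Fin (n + 1)) ℚ) (hc : ∀ l, ∃ μ ∈ Nt.support, μ l = 0)
    (d : Fin (n + 1) → ℤ) (e : Fin (n + 1) → Fin (n + 1) → ℤ)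
    (hint : IntegrableOn (fun x => MvPolynomial.aeval x Nt * ((∏ l, x l ^ d l) *
      ∏ i, ∏ j, if i ≤ j then (1 - CP⟪(n + 1), i, j, x⟫) ^ e i j else 1))
      {x : Fin (n + 1) → ℝ | ∀ i, x i ∈ Ioo (0:ℝ) 1}) :
    ∀ l, 0 ≤ d l := by
  classical
  set R : MvPolynomial (Fin (n + 1)) ℝ := MvPolynomial.map (algebraMap ℚ ℝ) Nt with hR
  have hRe : ∀ x : Fin (n + 1) → ℝ, eval x R = MvPolynomial.aeval x Nt := fun x => by
    rw [hR, eval_map, ← aeval_def]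
  have hRs : R.support = Nt.support := by
    rw [hR, support_map_of_injective _ (algebraMap ℚ ℝ).injective]
  -- the constant lower bound of the chordal factor on the half cube
  set κ : ℝ := ∏ i : Fin (n + 1), ∏ j : Fin (n + 1),
    if i ≤ j then ((2:ℝ) ^ (e i j).natAbs)⁻¹ * (1 / 2 : ℝ) ^ e i j else 1 with hκ
  have hκ0 : 0 < κ := Finset.prod_pos fun i _ => Finset.prod_pos fun j _ => by
    split_ifs
    · exact mul_pos (inv_pos.2 (pow_pos (by norm_num) _)) (zpow_pos (by norm_num) _)
    · exact one_pos
  have hbox : (Set.pi univ fun _ : Fin (n + 1) => Ioo (0:ℝ) (1 / 2)) ⊆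
      {x : Fin (n + 1) → ℝ | ∀ i, x i ∈ Ioo (0:ℝ) 1} := fun y hy i =>
    ⟨(hy i (mem_univ _)).1, (hy i (mem_univ _)).2.trans (by norm_num)⟩
  have hRint : IntegrableOn (fun x => |eval x R| * ∏ l, x l ^ d l)
      (Set.pi univ fun _ : Fin (n + 1) => Ioo (0:ℝ) (1 / 2)) := by
    have h1 := ((hint.mono_set hbox).norm).const_mul κ⁻¹
    refine Integrable.mono' h1 ?_ ?_
    · refine Measurable.aestronglyMeasurable ?_
      exact ((continuous_abs.comp (continuous_eval _)).measurable).mul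
        (Finset.measurable_prod _ fun l _ => (measurable_pi_apply l).pow_const _)
    · refine ae_restrict_of_forall_mem (MeasurableSet.univ_pi fun _ => measurableSet_Ioo)
        fun x hx => ?_
      have hx' : ∀ i, x i ∈ Ioo (0:ℝ) (1 / 2) := fun i => hx i (mem_univ _)
      have hx1 : ∀ i, x i ∈ Ioo (0:ℝ) 1 := hbox hx
      have hM0 : 0 < ∏ l, x l ^ d l := Finset.prod_pos fun l _ => zpow_pos (hx1 l).1 _
      have hK : κ ≤ ∏ i, ∏ j, if i ≤ j then (1 - CP⟪(n + 1), i, j, x⟫) ^ e i j else 1 := by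
        refine Finset.prod_le_prod (fun i _ => Finset.prod_nonneg fun j _ => ?_) fun i _ => ?_
        · split_ifs
          · exact (mul_pos (inv_pos.2 (pow_pos (by norm_num) _)) (zpow_pos (by norm_num) _)).le
          · exact zero_le_one
        refine Finset.prod_le_prod (fun j _ => ?_) fun j _ => ?_
        · split_ifs
          · exact (mul_pos (inv_pos.2 (pow_pos (by norm_num) _)) (zpow_pos (by norm_num) _)).le
          · exact zero_le_one
        · split_ifs with hij
          · exact chord_zpow_lower hij _ hx'
          · exact le_rfl
      have hlow : κ * (|eval x R| * ∏ l, x l ^ d l) ≤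
          ‖MvPolynomial.aeval x Nt * ((∏ l, x l ^ d l) *
            ∏ i, ∏ j, if i ≤ j then (1 - CP⟪(n + 1), i, j, x⟫) ^ e i j else 1)‖ := by
        rw [Real.norm_eq_abs, abs_mul, abs_mul, abs_of_pos hM0, hRe,
          abs_of_nonneg (hκ0.le.trans hK)]
        calc κ * (|MvPolynomial.aeval x Nt| * ∏ l, x l ^ d l)
            = |MvPolynomial.aeval x Nt| * ((∏ l, x l ^ d l) * κ) := by ring
          _ ≤ |MvPolynomial.aeval x Nt| * ((∏ l, x l ^ d l) *
              ∏ i, ∏ j, if i ≤ j then (1 - CP⟪(n + 1), i, j, x⟫) ^ e i j else 1) :=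
            mul_le_mul_of_nonneg_left (mul_le_mul_of_nonneg_left hK hM0.le) (abs_nonneg _)
      rw [Real.norm_of_nonneg (mul_nonneg (abs_nonneg _) hM0.le)]
      calc |eval x R| * ∏ l, x l ^ d l = κ⁻¹ * (κ * (|eval x R| * ∏ l, x l ^ d l)) := by
            field_simp
        _ ≤ _ := mul_le_mul_of_nonneg_left hlow (inv_nonneg.2 hκ0.le)
  have hB := neg_one_lt_of_integrableOn_abs_eval_mul R d (by norm_num) hRint
  intro l
  obtain ⟨μ, hμ, hμl⟩ := hc l
  have := hB μ (hRs ▸ hμ) l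
  rw [hμl] at this
  push_cast at this
  omega

end Faces

/-- **Registered sub-goal `stub_atomReduction_faces`** (tools V): FACES — absolute integrability of
`Ñ · x^d · K` on the cube with `Ñ` of zero content forces `d ≥ 0`. -/
theorem stub_atomReduction_faces : ∀ (n : ℕ) (Nt : MvPolynomial (Fin (n + 1)) ℚ), (∀ l, ∃ μ ∈ Nt.support, μ l = 0) → ∀ (d : Fin (n + 1) → ℤ) (e : Fin (n + 1) → Fin (n + 1) → ℤ), MeasureTheory.IntegrableOn (fun x : Fin (n + 1) → ℝ => MvPolynomial.aeval x Nt * ((∏ l, x l ^ d l) * ∏ i, ∏ j, if i ≤ j then (1 - (∏ l : Fin (n + 1), if i ≤ l ∧ l ≤ j then x l else 1)) ^ e i j else 1)) {x : Fin (n + 1) → ℝ | ∀ i, x i ∈ Set.Ioo (0:ℝ) 1} MeasureTheory.volume → ∀ l, 0 ≤ d l :=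
  fun _ Nt hc d e hint => exponent_nonneg Nt hc d e hint

end Summit.KontsevichZagierPeriods.DihedralNormalForm.TorusDescent.AtomReduction
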